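import Literature.Topology.FourManifolds.CircleMorse
import Literature.Topology.FourManifolds.MorseProofs

/-!
# Circle-valued Morse maps: finiteness of the critical set (proofs)

This file discharges the named fact
`Literature.Topology.FourManifolds.IsCircleMorse.finite_circleCriticalSet` of
`Literature/Topology/FourManifolds/CircleMorse.lean`: a circle-valued Morse map `f : M → S¹` on a
compact manifold has finitely many critical points (Milnor 1963, Cor. 2.3 — nondegenerate critical
points are isolated — applied to the local heights; Hirsch 1976, Ch. 6, §1: "the set of critical
points [of a Morse function] is a closed discrete subset of `M`"; for maps to `S¹` see Pajitnov 2006,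
Ch. 2, and Endo–Pajitnov 2017, §1.2).

## Proof

We follow the printed argument (isolation of nondegenerate critical points + closedness of the
critical set + compactness), reducing both ingredients to the real-valued case already proved in
`Literature/Topology/FourManifolds/MorseProofs.lean`:

* *Isolation.* Write `F = (↑) ∘ f : M → ℂ`. For every base point `p`, the local height
  `circleHeight f p = (w ↦ Im (w / F p)) ∘ F` is smooth, and by the chain rule every critical point
  of `f` is a critical point of `circleHeight f p` (no injectivity needed in this direction). At a
  critical point `p` of `f` the Hessian `circleHessian I f p` *is* the Hessian `mhessian` of the
  local height at `p`, so `eventually_not_isMCriticalPt_of_nondegenerate` (Milnor 1963, Cor. 2.3,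
  for real-valued functions) shows that `circleHeight f p`, hence `f`, has no other critical point
  near `p`.
* *Closedness.* The differential of the inclusion `S¹ ↪ ℂ` is injective
  (`mfderiv_coe_sphere_injective`), so `x` is critical for `f` iff it is critical for both real
  functions `Re ∘ F` and `Im ∘ F`; their critical sets are closed
  (`isClosed_criticalSet_of_contMDiff`).
* *Finiteness.* Closed in compact is compact; cover the critical set by the punctured-isolating
  neighbourhoods and extract a finite subcover, exactly as in `IsMorse.finite_criticalSet_holds`.
  Finite-dimensionality of the model space is automatic on a nonempty compact charted space
  (`Manifold.finiteDimensional_of_compactSpace`).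

## References

* J. Milnor, *Morse theory*, Ann. of Math. Studies 51 (1963), §2, Cor. 2.3. [Milnor1963]
* M. W. Hirsch, *Differential Topology*, GTM 33, Springer (1976), Ch. 6, §1 (held text
  `book:hirsch1976-differential-topology`, p. 135 of the scan).
* A. Pajitnov, *Circle-valued Morse theory*, de Gruyter Studies in Math. 32 (2006). [Pajitnov2006]
* H. Endo, A. Pajitnov, *On the Morse–Novikov number for 2-knots*, Osaka J. Math. 54 (2017),
  §1.2. [EndoPajitnov2017]
-/

open scoped Manifold ContDiff Topology
open Set Function Filter

noncomputable section

namespace Literature.Topology.FourManifolds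

section CircleCoe

/-- The inclusion `S¹ ↪ ℂ` is smooth (Mathlib's `contMDiff_coe_sphere`, specialised to
`Circle = sphere (0 : ℂ) 1`). [folklore] -/
theorem contMDiff_circle_coe {m : WithTop ℕ∞} :
    ContMDiff (𝓡 1) 𝓘(ℝ, ℂ) m (fun z : Circle => (z : ℂ)) :=
  haveI := finrank_real_complex_fact'
  contMDiff_coe_sphere

/-- The differential of the inclusion `S¹ ↪ ℂ` is injective at every point (Mathlib's
`mfderiv_coe_sphere_injective`, specialised to the circle). [folklore] -/
theorem mfderiv_circle_coe_injective (z : Circle) :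
    Injective (mfderiv (𝓡 1) 𝓘(ℝ, ℂ) (fun z : Circle => (z : ℂ)) z) :=
  haveI := finrank_real_complex_fact'
  mfderiv_coe_sphere_injective (E := ℂ) (n := 1) z

end CircleCoe

section CircleCritical

variable {E H : Type*} [NormedAddCommGroup E] [NormedSpace ℝ E] [TopologicalSpace H]
  {I : ModelWithCorners ℝ E H} {M : Type*} [TopologicalSpace M] [ChartedSpace H M]

/-- A `C^n` map `f : M → S¹` composed with the inclusion `S¹ ↪ ℂ` is `C^n`. [folklore] -/
theorem contMDiff_coe_comp_circle {n : WithTop ℕ∞} {f : M → Circle}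
    (hf : ContMDiff I (𝓡 1) n f) : ContMDiff I 𝓘(ℝ, ℂ) n (fun x => (f x : ℂ)) :=
  contMDiff_circle_coe.comp hf

/-- Chain rule for `F = (↑) ∘ f : M → ℂ`: `dF_y = d(↑)_{f y} ∘ df_y`. [folklore] -/
theorem mfderiv_coe_comp_circle {f : M → Circle} {y : M} (hf : MDifferentiableAt I (𝓡 1) f y) :
    mfderiv I 𝓘(ℝ, ℂ) (fun x => (f x : ℂ)) y =
      (mfderiv (𝓡 1) 𝓘(ℝ, ℂ) (fun z : Circle => (z : ℂ)) (f y)).comp (mfderiv I (𝓡 1) f y) := by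
  have hc : MDifferentiableAt (𝓡 1) 𝓘(ℝ, ℂ) (fun z : Circle => (z : ℂ)) (f y) :=
    (contMDiff_circle_coe (m := 1)).mdifferentiableAt one_ne_zero
  exact mfderiv_comp y hc hf

/-- `y` is a critical point of `f : M → S¹` iff the differential of `F = (↑) ∘ f : M → ℂ`
vanishes at `y` (the differential of `S¹ ↪ ℂ` being injective). [folklore] -/
theorem isCircleCriticalPt_iff_mfderiv_coe_comp_eq_zero {f : M → Circle} {y : M}
    (hf : MDifferentiableAt I (𝓡 1) f y) :
    IsCircleCriticalPt I f y ↔ mfderiv I 𝓘(ℝ, ℂ) (fun x => (f x : ℂ)) y = 0 := by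
  rw [IsCircleCriticalPt, mfderiv_coe_comp_circle hf]
  constructor
  · intro h
    rw [h, ContinuousLinearMap.comp_zero]
  · intro h
    refine ContinuousLinearMap.ext fun v => mfderiv_circle_coe_injective (f y) ?_
    have hv : (mfderiv (𝓡 1) 𝓘(ℝ, ℂ) (fun z : Circle => (z : ℂ)) (f y))
        (mfderiv I (𝓡 1) f y v) = 0 := by
      have := DFunLike.congr_fun h v
      exact this
    rw [hv]
    exact (map_zero _).symm

/-- `y` is a critical point of `f : M → S¹` iff it is a critical point of both real-valued
functions `Re ∘ f` and `Im ∘ f`. [folklore] -/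
theorem isCircleCriticalPt_iff_re_im {f : M → Circle} {y : M}
    (hf : MDifferentiableAt I (𝓡 1) f y) :
    IsCircleCriticalPt I f y ↔
      IsMCriticalPt I (fun x => (f x : ℂ).re) y ∧ IsMCriticalPt I (fun x => (f x : ℂ).im) y := by
  have hc : MDifferentiableAt (𝓡 1) 𝓘(ℝ, ℂ) (fun z : Circle => (z : ℂ)) (f y) :=
    (contMDiff_circle_coe (m := 1)).mdifferentiableAt one_ne_zero
  have hF : MDifferentiableAt I 𝓘(ℝ, ℂ) (fun x => (f x : ℂ)) y := hc.comp y hf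
  have hre_eq : (fun x => (f x : ℂ).re) = Complex.reCLM ∘ (fun x => (f x : ℂ)) := rfl
  have him_eq : (fun x => (f x : ℂ).im) = Complex.imCLM ∘ (fun x => (f x : ℂ)) := rfl
  have hre : mfderiv I 𝓘(ℝ, ℝ) (fun x => (f x : ℂ).re) y =
      Complex.reCLM.comp (mfderiv I 𝓘(ℝ, ℂ) (fun x => (f x : ℂ)) y) := by
    rw [hre_eq]
    exact (Complex.reCLM.hasMFDerivAt.comp y hF.hasMFDerivAt).mfderiv
  have him : mfderiv I 𝓘(ℝ, ℝ) (fun x => (f x : ℂ).im) y =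
      Complex.imCLM.comp (mfderiv I 𝓘(ℝ, ℂ) (fun x => (f x : ℂ)) y) := by
    rw [him_eq]
    exact (Complex.imCLM.hasMFDerivAt.comp y hF.hasMFDerivAt).mfderiv
  rw [isCircleCriticalPt_iff_mfderiv_coe_comp_eq_zero hf, IsMCriticalPt, IsMCriticalPt, hre, him]
  constructor
  · intro h
    have hv : ∀ v, (mfderiv I 𝓘(ℝ, ℂ) (fun x => (f x : ℂ)) y v : ℂ) = (0 : ℂ) := fun v => by
      rw [h]; rfl
    refine ⟨ContinuousLinearMap.ext fun v => ?_, ContinuousLinearMap.ext fun v => ?_⟩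
    · show Complex.reCLM (mfderiv I 𝓘(ℝ, ℂ) (fun x => (f x : ℂ)) y v) = 0
      rw [hv, map_zero]
    · show Complex.imCLM (mfderiv I 𝓘(ℝ, ℂ) (fun x => (f x : ℂ)) y v) = 0
      rw [hv, map_zero]
  · rintro ⟨h1, h2⟩
    refine ContinuousLinearMap.ext fun v => Complex.ext ?_ ?_
    · have e1 : (mfderiv I 𝓘(ℝ, ℂ) (fun x => (f x : ℂ)) y v).re = 0 := DFunLike.congr_fun h1 v
      rw [e1]; rfl
    · have e2 : (mfderiv I 𝓘(ℝ, ℂ) (fun x => (f x : ℂ)) y v).im = 0 := DFunLike.congr_fun h2 v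
      rw [e2]; rfl

/-- The local height `circleHeight f p = (w ↦ Im (w / f p)) ∘ ((↑) ∘ f)` of a `C^n` map
`f : M → S¹` is `C^n`. [folklore] -/
theorem contMDiff_circleHeight {n : WithTop ℕ∞} {f : M → Circle} (hf : ContMDiff I (𝓡 1) n f)
    (p : M) : ContMDiff I 𝓘(ℝ, ℝ) n (circleHeight f p) := by
  have hg : ContDiff ℝ n (fun w : ℂ => (w / (f p : ℂ)).im) :=
    Complex.imCLM.contDiff.comp (contDiff_id.div_const (f p : ℂ))
  have heq : circleHeight f p = (fun w : ℂ => (w / (f p : ℂ)).im) ∘ (fun x => (f x : ℂ)) := by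
    funext x
    simp only [circleHeight, Function.comp_apply, Circle.coe_div]
  rw [heq]
  exact hg.comp_contMDiff (contMDiff_coe_comp_circle hf)

/-- A critical point of `f : M → S¹` is a critical point of every local height `circleHeight f p`
(chain rule; this direction needs no injectivity). [folklore] -/
theorem IsCircleCriticalPt.isMCriticalPt_circleHeight {f : M → Circle} {y : M}
    (hf : MDifferentiableAt I (𝓡 1) f y) (hy : IsCircleCriticalPt I f y) (p : M) :
    IsMCriticalPt I (circleHeight f p) y := by
  have hc : MDifferentiableAt (𝓡 1) 𝓘(ℝ, ℂ) (fun z : Circle => (z : ℂ)) (f y) :=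
    (contMDiff_circle_coe (m := 1)).mdifferentiableAt one_ne_zero
  have hF : MDifferentiableAt I 𝓘(ℝ, ℂ) (fun x => (f x : ℂ)) y := hc.comp y hf
  have hF0 : mfderiv I 𝓘(ℝ, ℂ) (fun x => (f x : ℂ)) y = 0 :=
    (isCircleCriticalPt_iff_mfderiv_coe_comp_eq_zero hf).1 hy
  have hg : DifferentiableAt ℝ (fun w : ℂ => (w / (f p : ℂ)).im) (f y : ℂ) :=
    ((Complex.imCLM.contDiff.comp (contDiff_id.div_const (f p : ℂ))).differentiable
      one_ne_zero).differentiableAt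
  have hcomp : HasMFDerivAt I 𝓘(ℝ, ℝ) ((fun w : ℂ => (w / (f p : ℂ)).im) ∘ (fun x => (f x : ℂ))) y
      ((fderiv ℝ (fun w : ℂ => (w / (f p : ℂ)).im) (f y : ℂ)).comp
        (mfderiv I 𝓘(ℝ, ℂ) (fun x => (f x : ℂ)) y)) :=
    HasMFDerivAt.comp y hg.hasFDerivAt.hasMFDerivAt hF.hasMFDerivAt
  have heq : circleHeight f p = (fun w : ℂ => (w / (f p : ℂ)).im) ∘ (fun x => (f x : ℂ)) := by
    funext x
    simp only [circleHeight, Function.comp_apply, Circle.coe_div]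
  rw [IsMCriticalPt, heq, hcomp.mfderiv]
  refine ContinuousLinearMap.ext fun v => ?_
  show fderiv ℝ (fun w : ℂ => (w / (f p : ℂ)).im) (f y : ℂ)
    (mfderiv I 𝓘(ℝ, ℂ) (fun x => (f x : ℂ)) y v) = 0
  have hv : (mfderiv I 𝓘(ℝ, ℂ) (fun x => (f x : ℂ)) y v : ℂ) = (0 : ℂ) := by rw [hF0]; rfl
  rw [hv, map_zero]

/-- **Nondegenerate critical points of a circle-valued map are isolated** (Milnor 1963, Cor. 2.3,
applied to the local height at the critical point): for a `C^n` map `f : M → S¹`, `n ≥ 2`, on a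
manifold (possibly with boundary and corners) modelled on a finite-dimensional space, near a
critical point `p` with nondegenerate `circleHessian` there is no other critical point.
[cite: Milnor1963, Cor. 2.3 (via local heights)] -/
theorem eventually_not_isCircleCriticalPt_of_nondegenerate [FiniteDimensional ℝ E]
    {n : WithTop ℕ∞} [IsManifold I n M] {f : M → Circle} (hf : ContMDiff I (𝓡 1) n f)
    (hn : 2 ≤ n) {p : M} (hp : IsCircleCriticalPt I f p)
    (hH : (circleHessian I f p).Nondegenerate) :
    ∀ᶠ x in 𝓝[≠] p, ¬ IsCircleCriticalPt I f x := by
  have hn1 : (1 : WithTop ℕ∞) ≤ n := le_trans (by norm_num) hn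
  have hn0 : n ≠ 0 := by rintro rfl; exact absurd hn1 (by norm_num)
  have h := eventually_not_isMCriticalPt_of_nondegenerate (contMDiff_circleHeight hf p) hn
    (hp.isMCriticalPt_circleHeight (hf.mdifferentiableAt hn0) p) hH
  filter_upwards [h] with x hx hcrit
  exact hx (hcrit.isMCriticalPt_circleHeight (hf.mdifferentiableAt hn0) p)

/-- The critical set of a `C^n` map `f : M → S¹`, `n ≥ 2`, is closed (continuity of `df`; it is
the intersection of the critical sets of `Re ∘ f` and `Im ∘ f`). [cite: Milnor1963, §2] -/
theorem isClosed_circleCriticalSet_of_contMDiff {n : WithTop ℕ∞} [IsManifold I n M]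
    {f : M → Circle} (hf : ContMDiff I (𝓡 1) n f) (hn : 2 ≤ n) :
    IsClosed (circleCriticalSet I f) := by
  have hn1 : (1 : WithTop ℕ∞) ≤ n := le_trans (by norm_num) hn
  have hn0 : n ≠ 0 := by rintro rfl; exact absurd hn1 (by norm_num)
  have hF : ContMDiff I 𝓘(ℝ, ℂ) n (fun x => (f x : ℂ)) := contMDiff_coe_comp_circle hf
  have hre : ContMDiff I 𝓘(ℝ, ℝ) n (fun x => (f x : ℂ).re) :=
    Complex.reCLM.contDiff.comp_contMDiff hF
  have him : ContMDiff I 𝓘(ℝ, ℝ) n (fun x => (f x : ℂ).im) :=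
    Complex.imCLM.contDiff.comp_contMDiff hF
  have heq : circleCriticalSet I f =
      criticalSet I (fun x => (f x : ℂ).re) ∩ criticalSet I (fun x => (f x : ℂ).im) := by
    ext y
    simp only [mem_circleCriticalSet, mem_inter_iff, mem_criticalSet]
    exact isCircleCriticalPt_iff_re_im (hf.mdifferentiableAt hn0)
  rw [heq]
  exact (isClosed_criticalSet_of_contMDiff hre hn).inter (isClosed_criticalSet_of_contMDiff him hn)

/-- Discharge of `IsCircleMorse.finite_circleCriticalSet`: a circle-valued Morse map on a compact
manifold (possibly with boundary and corners; no separation axiom and no finite-dimensionality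
assumed, the latter being automatic) has finitely many critical points — nondegenerate critical
points are isolated (Milnor 1963, Cor. 2.3, applied to the local heights) and the critical set is
closed, hence compact. [cite: Milnor1963, Cor. 2.3 (via local heights)] -/
theorem IsCircleMorse.finite_circleCriticalSet_holds :
    IsCircleMorse.finite_circleCriticalSet (I := I) (M := M) := by
  intro _ _ f hf
  rcases isEmpty_or_nonempty M with hM | hM
  · exact Set.toFinite _
  haveI := Manifold.finiteDimensional_of_compactSpace I M
  have h2 : (2 : WithTop ℕ∞) ≤ ∞ := by norm_cast
  have hcpt : IsCompact (circleCriticalSet I f) :=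
    (isClosed_circleCriticalSet_of_contMDiff hf.1 h2).isCompact
  obtain ⟨t, -, hcover⟩ := hcpt.elim_nhds_subcover
    (fun p => {x | x = p ∨ ¬ IsCircleCriticalPt I f x}) fun p hp => by
      have := eventually_not_isCircleCriticalPt_of_nondegenerate hf.1 h2 hp (hf.2 p hp)
      rw [eventually_nhdsWithin_iff] at this
      filter_upwards [this] with x hx
      by_cases hxp : x = p
      · exact Or.inl hxp
      · exact Or.inr (hx hxp)
  refine t.finite_toSet.subset fun x hx => ?_
  obtain ⟨p, hpt, hxp⟩ := mem_iUnion₂.1 (hcover hx)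
  rcases hxp with rfl | h
  · exact hpt
  · exact absurd hx h

end CircleCritical

end Literature.Topology.FourManifolds
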